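import Mathlib
import Summits.Ventures.HodgeRepro.Tier4.Common.SettingOfData
import Summits.Ventures.HodgeRepro.Tier4.Common.L1Convolution
import Summits.Ventures.HodgeRepro.Tier4.Line1.SecondCountableGA
import Summits.Ventures.HodgeRepro.Tier4.Line1.RtfGeometric
import Summits.Ventures.HodgeRepro.Tier4.Line4.LatticeCount
import Summits.Ventures.HodgeRepro.Tier4.Line4.KernelL1

/-!
# Tier4/Line4/GeometricBridgeL1 — the adelic bridge `Jc = J` for an `L¹` test function

Blind re-derivation cell `pub-hodge-repro`, Tier 4 «prove the step» (README §9–§10), seat t4-L4-p2 (prover, LINE L4,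
gen 4; C-L4-KERNELL1 (K6), S14853).  Tree path `lean/Summits/Ventures/HodgeRepro/Tier4/Line4/GeometricBridgeL1.lean`.
Mathlib-level; no literature; no `def`.

`GeometricBridge.Jc_eq_J` (this seat, gen 2) identifies the `periodLin`-defined distribution `R.Jc f` of `Common/AdelicRTF`
with L1's iterated set integral `S.J R.chi R.chi' f` on `Setting.ofAdelicData`, for a COMPACTLY SUPPORTED `f` (the kernel is
a finite sum there).  After F-L4-PSEUDO-VACUOUS (census §12.15) the line's first test function is only integrable at `w₀`;
this module is the same identity for a continuous `f` whose Poincaré series satisfies the (α)-form uniform bound of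
S14790 / (R-12) — the kernel is then strongly measurable and bounded on `closure D_T × closure D_{T′}` (`KernelL1`), so both
integrands of `Jc` are integrable and `periodLin_eq_integral` applies twice.  `Jc_eq_J_of_isTestL1_conv` is the instance
the line consumes: `f = f₁ ⋆ f₂` with `f₁ ∈ L¹` (`Common.IsTestL1`) and `f₂` a test function, the bound being
`LatticeCount.poincareUniform_conv_of_isTestL1`.  `U(W)(𝔸)` is second countable (`secondCountable_GA`) and `U(W)(k)` is
countable (`rationalPoints_countable`), as `KernelL1` asks.

Nothing here says anything about the status of the Hodge conjecture for CM abelian varieties, which is NOT proved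
(HC_CM is NOT proved by anyone in this repository).
-/

set_option autoImplicit false

noncomputable section

namespace Summit.Ventures.HodgeRepro.Tier4.Line4

open Summit.Ventures.HodgeRepro.Tier4.Common Summit.Ventures.HodgeRepro.Tier4.Line1 MeasureTheory NumberField
  Topology Filter

section BridgeL1

variable {k : Type} [Field k] [NumberField k] (W : PlaneData k) [MeasurableSpace (GA W)] [BorelSpace (GA W)]
  (R : RTFData W) (μ : Measure (GA W)) [μ.IsHaarMeasure] [R.μT.IsHaarMeasure] [R.μT'.IsHaarMeasure]
  (DG : Set (GA W)) (fdG : IsFundamentalDomain (rationalPoints W) DG μ) (compG : IsCompact (closure DG))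
  (compT : IsCompact (closure R.DT)) (compT' : IsCompact (closure R.DT'))

/-- **`Jc = J` for a continuous `f` with the (α)-form Poincaré bound** (the `L¹` twin of `GeometricBridge.Jc_eq_J`):
both integrands of `R.Jc f` are integrable (`KernelL1`: the kernel is strongly measurable and bounded on the closures of
the toric domains), so the two `periodLin`s are the two set integrals of `S.J`. -/
theorem Jc_eq_J_of_poincareUniform (hc : Continuous R.chi) (hu : ∀ a, ‖R.chi a‖ = 1) (hc' : Continuous R.chi')
    (hu' : ∀ a, ‖R.chi' a‖ = 1) {f : GA W → ℂ} (hf : Continuous f)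
    (hP : ∀ C₁ C₂ : Set (GA W), IsCompact C₁ → IsCompact C₂ → ∃ M : ℝ, ∀ x ∈ C₁, ∀ y ∈ C₂,
      Summable (fun γ : rationalPoints W => ‖f (x⁻¹ * γ * y)‖) ∧
        ∑' γ : rationalPoints W, ‖f (x⁻¹ * γ * y)‖ ≤ M) :
    R.Jc f = (Setting.ofAdelicData W R μ DG fdG compG compT compT').J R.chi R.chi' f := by
  set S := Setting.ofAdelicData W R μ DG fdG compG compT compT' with hS
  haveI : SecondCountableTopology (GA W) := secondCountable_GA W
  haveI : Countable S.Gk := rationalPoints_countable W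
  have hP' : ∀ C₁ C₂ : Set (GA W), IsCompact C₁ → IsCompact C₂ → ∃ M : ℝ, ∀ x ∈ C₁, ∀ y ∈ C₂,
      Summable (fun γ : S.Gk => ‖f (x⁻¹ * γ * y)‖) ∧ ∑' γ : S.Gk, ‖f (x⁻¹ * γ * y)‖ ≤ M := hP
  -- the inner period is the inner integral, for `t ∈ closure D_T`
  have hinner : ∀ t ∈ closure S.DT,
      Integrable (fun t' : torusT' W => R.chi'conj t' * kernel W f (t : GA W) (t' : GA W))
        (R.μT'.restrict R.DT') := by
    intro t ht
    have h := integrableOn_kernel_mul_DT' S hf hP' (fun _ => (1 : ℂ)) hc' hu' ht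
    refine h.congr (Eventually.of_forall fun t' => ?_)
    show S.kernel f t t' * 1 * starRingEnd ℂ (R.chi' t') = R.chi'conj t' * S.kernel f t t'
    unfold RTFData.chi'conj
    ring
  have hinnerEq : ∀ t ∈ closure S.DT,
      R.periodT'conj (fun t' : torusT' W => kernel W f (t : GA W) (t' : GA W)) =
        ∫ t' in R.DT', R.chi'conj t' * kernel W f (t : GA W) (t' : GA W) ∂(R.μT') := by
    intro t ht
    unfold RTFData.periodT'conj
    exact periodLin_eq_integral W R.μT' R.DT' R.chi'conj (hinner t ht)
  -- the outer integrand is integrable on `D_T`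
  have houter : Integrable (fun t : torusT W => R.chi t *
      R.periodT'conj (fun t' : torusT' W => kernel W f (t : GA W) (t' : GA W))) (R.μT.restrict R.DT) := by
    have h := integrableOn_integral_kernel_mul_DT S hf hP' hc hu hc' hu'
    refine h.congr ?_
    refine ae_restrict_of_ae_restrict_of_subset subset_closure ?_
    rw [ae_restrict_iff' isClosed_closure.measurableSet]
    refine Eventually.of_forall fun t ht => ?_
    show ∫ t' in S.DT', S.kernel f t t' * R.chi t * starRingEnd ℂ (R.chi' t') ∂S.μT' =
      R.chi t * R.periodT'conj (fun t' : torusT' W => kernel W f (t : GA W) (t' : GA W))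
    rw [hinnerEq t ht, ← integral_const_mul]
    congr 1
    funext t'
    unfold RTFData.chi'conj
    show S.kernel f t t' * R.chi t * starRingEnd ℂ (R.chi' t') = R.chi t * (starRingEnd ℂ (R.chi' t') * S.kernel f t t')
    ring
  -- assemble
  unfold RTFData.Jc RTFData.periodT
  rw [periodLin_eq_integral W R.μT R.DT R.chi houter]
  show _ = ∫ t in S.DT, ∫ t' in S.DT', S.kernel f t t' * R.chi t * starRingEnd ℂ (R.chi' t') ∂S.μT' ∂S.μT
  apply RTF.Geometric.setIntegral_congr_of_eqOn_closure
  intro t ht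
  beta_reduce
  rw [hinnerEq t ht, ← integral_const_mul]
  apply RTF.Geometric.setIntegral_congr_of_eqOn_closure
  intro t' _
  beta_reduce
  show R.chi t * (R.chi'conj t' * S.kernel f t t') = S.kernel f t t' * R.chi t * starRingEnd ℂ (R.chi' t')
  unfold RTFData.chi'conj
  ring

/-- **`Jc = J` for `f = f₁ ⋆ f₂`, `f₁ ∈ L¹`, `f₂ ∈ C_c`** — the instance the line consumes after F-L4-PSEUDO-VACUOUS
(the first test function is integrable, not compactly supported, at `w₀`); the Poincaré bound is
`LatticeCount.poincareUniform_conv_of_isTestL1`, the continuity `Common.continuous_conv_of_integrable_of_isTest`. -/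
theorem Jc_eq_J_of_isTestL1_conv (hc : Continuous R.chi) (hu : ∀ a, ‖R.chi a‖ = 1) (hc' : Continuous R.chi')
    (hu' : ∀ a, ‖R.chi' a‖ = 1) {f₁ f₂ : GA W → ℂ}
    (h₁ : IsTestL1 (Setting.ofAdelicData W R μ DG fdG compG compT compT') f₁) (h₂ : RTF.IsTest f₂) :
    R.Jc ((Setting.ofAdelicData W R μ DG fdG compG compT compT').conv f₁ f₂) =
      (Setting.ofAdelicData W R μ DG fdG compG compT compT').J R.chi R.chi'
        ((Setting.ofAdelicData W R μ DG fdG compG compT compT').conv f₁ f₂) := by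
  set S := Setting.ofAdelicData W R μ DG fdG compG compT compT' with hS
  haveI : SecondCountableTopology (GA W) := secondCountable_GA W
  exact Jc_eq_J_of_poincareUniform W R μ DG fdG compG compT compT' hc hu hc' hu'
    (continuous_conv_of_integrable_of_isTest S h₁.1 h₁.2 h₂) (poincareUniform_conv_of_isTestL1 S h₁ h₂)

end BridgeL1

end Summit.Ventures.HodgeRepro.Tier4.Line4

end
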